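import Summits.HodgeConjecture.CorCM.IrreducibleOddWeightsCanonicalPivotCMFields
import Summits.HodgeConjecture.CorCM.DistinctImaginaryQuadraticSexticCMHodge
import HarnessLib

/-!
# Canonical pivot, VII: ODD TRACES and PRIME DIMENSION — a CM abelian variety whose field meets the Galois closure of
# the partner's field in ODD degree, or of PRIME dimension `p` with no embedding into and no imaginary quadratic field
# shared with that closure, has `Hg(A₀ × A₁) = Hg(A₀) × Hg(A₁)` whatever the types

COR-CM (cell `pub-hodgecm2`, binder seat `b16` gen 65, count-neutral claim CANONICAL PIVOT, file C8 — CM fields and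
realisations; theorems only, no definition, no named fact, no `sorry`).  NEW as stated, hence under `Summits/`.  HONEST
FRAMING: unconditional statements about `dim MT(A₀ × A₁)` for abelian varieties with complex multiplication read from
DEGREES of the fields; no Hodge class is claimed algebraic beyond the tree's nondegenerate case; `HC_CM` is neither used
nor asserted.

File C2 (`IrreducibleOddWeightsCanonicalPivotCMFields`): if the TRACE `a(K_{i₀}) ∩ L₁` (`L₁ = normalClosure ℚ K_{i₁} ℂ`)
is real for every embedding `a` of `K_{i₀}`, then `Hg(A₀ × A₁) = Hg(A₀) × Hg(A₁)` for ALL CM types.  The trace is a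
subfield of the CM field `a(K_{i₀})` stable under complex conjugation, hence totally real or CM — and CM forces EVEN
degree (Artin: the fixed field of conjugation has index `2`).  Hence:

* §1 `conj_mem_normalClosure` (with the tree's `WeilFibre.conj_mem_fieldRange` and Artin's parity lemma
  `WeilFibre.even_finrank_of_conj_mem` of `DistinctImaginaryQuadraticSexticCMHodge`: a conjugation-stable subfield of
  `ℂ` moved by conjugation has even degree).
* §2 **`cmFamilyRank_add_card_eq_pair_of_forall_odd_finrank_inf`** — **ODD TRACE DEGREE `[a(K_{i₀}) ∩ L₁ : ℚ]` for every
  `a` ⟹ `Hg(A₀ × A₁) = Hg(A₀) × Hg(A₁)` for all types** (+ nondegenerate iff both, product span on every `A₀^a × A₁^b`,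
  HC for nondegenerate types: `…_of_forall_odd_finrank_inf`).
* §3 **PRIME DIMENSION** — `[K_{i₀} : ℚ] = 2p`, `p` prime (`dim A₀ = p`): the trace has degree `1, 2, p` or `2p`, and is
  non-real only if it is an imaginary quadratic field or all of `a(K_{i₀})`.  So
  **`cmFamilyRank_add_card_eq_pair_of_finrank_eq_two_mul_prime`**: if `K_{i₀}` does NOT embed into `L₁`
  (`¬ a(K_{i₀}) ≤ L₁`) and every quadratic subfield of `a(K_{i₀})` inside `L₁` is real (e.g. `K_{i₀}` has no imaginary
  quadratic subfield, automatic for `p = 2` non-Galois… or `L₁` has none in common with it), then `Hg(A₀ × A₁) =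
  Hg(A₀) × Hg(A₁)` FOR EVERY CM type of `K_{i₀}` and EVERY CM abelian variety `A₁` with multiplication by `K_{i₁}` — a
  CM abelian variety of prime dimension interacts with a partner only through an embedding of its field into the
  partner's Galois closure or through a shared imaginary quadratic field (+ HC corollary for nondegenerate types).
  The tree had the cases `p = 1` (`CMTypeRankForeignQuadraticSlot`: `Hg(E × A)`), both slots of prime degree
  (`DistinctPrimeDimensionsCMHodge`, `GaloisCMFieldsPrimeDegreePair`) and dihedral quartics (`QuarticCMClosureRealIntersections`).

## References

* [Lang2002] S. Lang, *Algebra*, 3rd ed., VI §1 Thm. 1.8 (Artin), Thm. 1.12, Cor. 1.6.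
* [Shimura1998] G. Shimura, *Abelian Varieties with Complex Multiplication and Modular Functions*, §18.1–18.2.
* [Gordon1999HodgeAVSurvey] B. B. Gordon, *A survey of the Hodge conjecture for abelian varieties*, §3 Theorem (proof),
  7.5–7.7, 10.10.
* [MoonenZarhin1999LowDim] B. Moonen, Yu. Zarhin, Math. Ann. 315 (1999), Thm. (0.2).
-/

set_option autoImplicit false

noncomputable section

open scoped BigOperators Classical

open CategoryTheory CategoryTheory.Limits NumberField Module IntermediateField

namespace Summit.HodgeConjecture.CorCM

open Literature.NumberTheory.ComplexMultiplication
open Literature.AlgebraicGeometry.Motives (AbelianVariety CMType)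
open Literature.AlgebraicGeometry.Motives.AbelianVariety
open Literature.AlgebraicGeometry.HodgeTheory
open Literature.AlgebraicGeometry.ComplexMultiplication (IsCMTypeRealisation)
open Literature.AlgebraicGeometry.Pohlmann1968

variable {I : Type} [Fintype I] {K : I → Type} [∀ i, Field (K i)] [∀ i, NumberField (K i)] [∀ i, IsCMField (K i)]

/-! ### §1 Conjugation-stable subfields of `ℂ` -/

omit [Fintype I] [∀ i, IsCMField (K i)] in
/-- The image of an embedding of a number field is finite over `ℚ`. [folklore] -/
private theorem finiteDimensional_fieldRange₈ {i : I} (a : K i →+* ℂ) : FiniteDimensional ℚ a.toRatAlgHom.fieldRange :=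
  LinearEquiv.finiteDimensional (AlgEquiv.ofInjectiveField a.toRatAlgHom).toLinearEquiv

/-- A subfield of a finite extension inside `ℂ` is finite. [folklore] -/
private theorem finiteDimensional_of_le₈ {E E' : IntermediateField ℚ ℂ} [FiniteDimensional ℚ E] (h : E' ≤ E) :
    FiniteDimensional ℚ E' :=
  FiniteDimensional.of_injective (IntermediateField.inclusion h).toLinearMap (IntermediateField.inclusion_injective h)

omit [Fintype I] [∀ i, IsCMField (K i)] in
/-- The Galois closure of a number field in `ℂ` is stable under complex conjugation (the compositum of the images of all
embeddings, permuted by conjugation). [cite: Lang2002, V §3 Thm. 3.3] -/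
theorem conj_mem_normalClosure (i : I) {z : ℂ} (hz : z ∈ normalClosure ℚ (K i) ℂ) :
    starRingEnd ℂ z ∈ normalClosure ℚ (K i) ℂ := by
  let φ : ℂ →ₐ[ℚ] ℂ := (AlgEquiv.ofRingEquiv (f := (starRingAut : ℂ ≃+* ℂ)) fun q => by
    rw [eq_ratCast, map_ratCast]).toAlgHom
  have hle : normalClosure ℚ (K i) ℂ ≤ (normalClosure ℚ (K i) ℂ).comap φ := by
    refine normalClosure_le_iff.2 fun f => ?_
    rintro _ ⟨y, rfl⟩
    change φ (f y) ∈ normalClosure ℚ (K i) ℂ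
    exact (φ.comp f).fieldRange_le_normalClosure ⟨y, rfl⟩
  exact hle hz

/-! ### §2 Odd trace degree -/

omit [Fintype I] in
/-- **A trace of ODD degree is real**: if `[a(K_{i₀}) ∩ L₁ : ℚ]` is odd, complex conjugation fixes the trace pointwise
(the trace is conjugation-stable, and a moved element would make its degree even).
[cite: Lang2002, VI §1 Thm. 1.8] [cite: Shimura1998, §18.1] -/
theorem conj_apply_eq_of_odd_finrank_inf {i₀ i₁ : I} (a : K i₀ →+* ℂ)
    (hodd : Odd (finrank ℚ ↥(a.toRatAlgHom.fieldRange ⊓ normalClosure ℚ (K i₁) ℂ))) (k : K i₀)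
    (hk : a k ∈ normalClosure ℚ (K i₁) ℂ) : starRingEnd ℂ (a k) = a k := by
  haveI := finiteDimensional_fieldRange₈ a
  haveI : FiniteDimensional ℚ ↥(a.toRatAlgHom.fieldRange ⊓ normalClosure ℚ (K i₁) ℂ) :=
    finiteDimensional_of_le₈ inf_le_left
  by_contra hne
  have h2 := WeilFibre.even_finrank_of_conj_mem (a.toRatAlgHom.fieldRange ⊓ normalClosure ℚ (K i₁) ℂ)
    (fun z hz => ⟨WeilFibre.conj_mem_fieldRange a hz.1, conj_mem_normalClosure i₁ hz.2⟩)
    ⟨AlgHom.mem_fieldRange.2 ⟨k, rfl⟩, hk⟩ hne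
  exact (Nat.not_even_iff_odd.2 hodd) (even_iff_two_dvd.2 h2)

/-- **ODD TRACE DEGREE ⟹ `Hg(A₀ × A₁) = Hg(A₀) × Hg(A₁)` FOR ALL TYPES**: if for every embedding `a` of `K_{i₀}` the
trace `a(K_{i₀}) ∩ L₁` has odd degree over `ℚ`, then `cmFamilyRank Φ + 2 = cmTypeRank Φ₀ + cmTypeRank Φ₁ + 1` for every
pair of CM types. [cite: Gordon1999HodgeAVSurvey, §3 Theorem (proof) and 7.5–7.7] [cite: Lang2002, VI §1 Thm. 1.8] -/
theorem cmFamilyRank_add_card_eq_pair_of_forall_odd_finrank_inf {i₀ i₁ : I} (h01 : i₀ ≠ i₁) (hI : ∀ l, l = i₀ ∨ l = i₁)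
    (Φ : ∀ i, CMType (K i))
    (hodd : ∀ a : K i₀ →+* ℂ, Odd (finrank ℚ ↥(a.toRatAlgHom.fieldRange ⊓ normalClosure ℚ (K i₁) ℂ))) :
    CMAlgebra.cmFamilyRank Φ + Fintype.card I = (∑ i, cmTypeRank (Φ i)) + 1 :=
  cmFamilyRank_add_card_eq_pair_of_forall_conj_apply_eq h01 hI Φ fun a k hk =>
    conj_apply_eq_of_odd_finrank_inf a (hodd a) k hk

/-- … then the pair is nondegenerate iff both members are. [cite: Gordon1999HodgeAVSurvey, 7.5–7.6.1] -/
theorem isNondegenerateFamily_iff_forall_of_forall_odd_finrank_inf {i₀ i₁ : I} (h01 : i₀ ≠ i₁)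
    (hI : ∀ l, l = i₀ ∨ l = i₁) (Φ : ∀ i, CMType (K i))
    (hodd : ∀ a : K i₀ →+* ℂ, Odd (finrank ℚ ↥(a.toRatAlgHom.fieldRange ⊓ normalClosure ℚ (K i₁) ℂ))) :
    CMAlgebra.IsNondegenerateFamily Φ ↔ ∀ i, IsNondegenerate (Φ i) :=
  isNondegenerateFamily_iff_forall_of_forall_conj_apply_eq h01 hI Φ fun a k hk =>
    conj_apply_eq_of_odd_finrank_inf a (hodd a) k hk

section Hodge

variable {Φ : ∀ i, CMType (K i)} {A : I → AbelianVariety ℂ} {ιA : ∀ i, 𝓞 (K i) →+* End (A i)}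
  {θ : ∀ i, K i →+* Module.End ℂ (complexBetti (A i).X 1)}

/-- … and every rational Hodge class on every `A₀^a × A₁^b` (disjoint slot maps) is a sum of exterior products.
[cite: MoonenZarhin1999LowDim, §3 (3.1)] -/
theorem forall_hodgeClassesProductSpan_pair_of_forall_odd_finrank_inf {i₀ i₁ : I} (h01 : i₀ ≠ i₁)
    (hI : ∀ l, l = i₀ ∨ l = i₁)
    (hodd : ∀ a : K i₀ →+* ℂ, Odd (finrank ℚ ↥(a.toRatAlgHom.fieldRange ⊓ normalClosure ℚ (K i₁) ℂ)))
    (hA : ∀ i, IsCMTypeRealisation (Φ i) (A i) (ιA i) (θ i)) (N₁ N₂ : ℕ) [NeZero N₁] [NeZero N₂] (π₁ : Fin N₁ → I)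
    (π₂ : Fin N₂ → I) (hdisj : ∀ l₁ l₂, π₁ l₁ ≠ π₂ l₂) :
    HodgeClassesProductSpan (⨁ fun l => A (π₁ l)) (⨁ fun l => A (π₂ l)) :=
  forall_hodgeClassesProductSpan_pair_of_forall_conj_apply_eq h01 hI
    (fun a k hk => conj_apply_eq_of_odd_finrank_inf a (hodd a) k hk) hA N₁ N₂ π₁ π₂ hdisj

/-- … and for nondegenerate types every `A₀^a × A₁^b` satisfies the Hodge conjecture, unconditionally.
[cite: Gordon1999HodgeAVSurvey, 10.10 and 7.5] -/
theorem hodgeConjectureFor_prod_of_forall_odd_finrank_inf {i₀ i₁ : I} (h01 : i₀ ≠ i₁) (hI : ∀ l, l = i₀ ∨ l = i₁)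
    (hodd : ∀ a : K i₀ →+* ℂ, Odd (finrank ℚ ↥(a.toRatAlgHom.fieldRange ⊓ normalClosure ℚ (K i₁) ℂ)))
    (hnd : ∀ i, IsNondegenerate (Φ i)) (hA : ∀ i, IsCMTypeRealisation (Φ i) (A i) (ιA i) (θ i)) {N : ℕ}
    (π : Fin N → I) :
    HodgeConjectureFor (⨁ fun l : Fin N => A (π l)).dim (⨁ fun l : Fin N => A (π l)).X :=
  hodgeConjectureFor_prod_of_forall_conj_apply_eq h01 hI
    (fun a k hk => conj_apply_eq_of_odd_finrank_inf a (hodd a) k hk) hnd hA π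

end Hodge

/-! ### §3 Prime dimension -/

omit [Fintype I] in
/-- **The trace of a CM field of degree `2p` (`p` prime) is real unless it is an imaginary quadratic field or the whole
field**: if `a(K_{i₀}) ⊄ L₁` and every quadratic subfield of `a(K_{i₀})` lying in `L₁` is real, complex conjugation
fixes `a(K_{i₀}) ∩ L₁` pointwise (its degree divides `2p`, and is even if conjugation moves it).
[cite: Lang2002, VI §1 Thm. 1.8 and Thm. 1.12] [cite: Shimura1998, §18.1] -/
theorem conj_apply_eq_of_finrank_eq_two_mul_prime {i₀ i₁ : I} {p : ℕ} (hp : p.Prime)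
    (hK : finrank ℚ (K i₀) = 2 * p) (a : K i₀ →+* ℂ)
    (h1 : ¬ a.toRatAlgHom.fieldRange ≤ normalClosure ℚ (K i₁) ℂ)
    (h2 : ∀ F : IntermediateField ℚ ℂ, F ≤ a.toRatAlgHom.fieldRange → F ≤ normalClosure ℚ (K i₁) ℂ →
      finrank ℚ F = 2 → ∀ z : ℂ, z ∈ F → starRingEnd ℂ z = z)
    (k : K i₀) (hk : a k ∈ normalClosure ℚ (K i₁) ℂ) : starRingEnd ℂ (a k) = a k := by
  haveI := finiteDimensional_fieldRange₈ a
  haveI : FiniteDimensional ℚ ↥(a.toRatAlgHom.fieldRange ⊓ normalClosure ℚ (K i₁) ℂ) :=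
    finiteDimensional_of_le₈ inf_le_left
  by_contra hne
  have hzQ : a k ∈ a.toRatAlgHom.fieldRange ⊓ normalClosure ℚ (K i₁) ℂ := ⟨AlgHom.mem_fieldRange.2 ⟨k, rfl⟩, hk⟩
  -- the degree `d` of the trace is even and divides `2p`
  obtain ⟨e, he⟩ := WeilFibre.even_finrank_of_conj_mem (a.toRatAlgHom.fieldRange ⊓ normalClosure ℚ (K i₁) ℂ)
    (fun z hz => ⟨WeilFibre.conj_mem_fieldRange a hz.1, conj_mem_normalClosure i₁ hz.2⟩) hzQ hne
  have hS : finrank ℚ ↥a.toRatAlgHom.fieldRange = 2 * p := by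
    have e' : finrank ℚ (K i₀) = finrank ℚ ↥(a.toRatAlgHom).fieldRange :=
      (AlgEquiv.ofInjectiveField a.toRatAlgHom).toLinearEquiv.finrank_eq
    rw [← e', hK]
  have hdvd : finrank ℚ ↥(a.toRatAlgHom.fieldRange ⊓ normalClosure ℚ (K i₁) ℂ) ∣ 2 * p := by
    rw [← hS]
    exact Dvd.intro _ (IntermediateField.finrank_bot_mul_relfinrank
      (inf_le_left : a.toRatAlgHom.fieldRange ⊓ normalClosure ℚ (K i₁) ℂ ≤ a.toRatAlgHom.fieldRange))
  rw [he] at hdvd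
  have hep : e ∣ p := Nat.dvd_of_mul_dvd_mul_left (by norm_num) hdvd
  rcases (Nat.dvd_prime hp).1 hep with rfl | rfl
  · -- the trace is a quadratic field inside `L₁`: real by hypothesis
    exact hne (h2 _ inf_le_left inf_le_right (by rw [he]) _ hzQ)
  · -- the trace is all of `a(K_{i₀})`: then `a(K_{i₀}) ≤ L₁`
    have heq : a.toRatAlgHom.fieldRange ⊓ normalClosure ℚ (K i₁) ℂ = a.toRatAlgHom.fieldRange :=
      IntermediateField.eq_of_le_of_finrank_le inf_le_left (by rw [hS, he])
    exact h1 (heq ▸ inf_le_right)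

/-- **PRIME DIMENSION ⟹ `Hg(A₀ × A₁) = Hg(A₀) × Hg(A₁)` FOR ALL TYPES, unless `K_{i₀}` embeds into `L₁` or shares an
imaginary quadratic field with it.**  `[K_{i₀} : ℚ] = 2p` with `p` prime (`dim A₀ = p`); if no embedding `a` has
`a(K_{i₀}) ⊆ L₁` and every quadratic subfield of `a(K_{i₀})` inside `L₁` is real, then `cmFamilyRank Φ + 2 =
cmTypeRank Φ₀ + cmTypeRank Φ₁ + 1` for every CM type `Φ₀` of `K_{i₀}` and every `Φ₁` of the arbitrary CM field `K_{i₁}`.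
[cite: Gordon1999HodgeAVSurvey, §3 Theorem (proof) and 7.5–7.7] [cite: MoonenZarhin1999LowDim, Thm. (0.2)]
[cite: Lang2002, VI §1 Thm. 1.8 and Thm. 1.12] -/
theorem cmFamilyRank_add_card_eq_pair_of_finrank_eq_two_mul_prime {i₀ i₁ : I} (h01 : i₀ ≠ i₁)
    (hI : ∀ l, l = i₀ ∨ l = i₁) (Φ : ∀ i, CMType (K i)) {p : ℕ} (hp : p.Prime) (hK : finrank ℚ (K i₀) = 2 * p)
    (h1 : ∀ a : K i₀ →+* ℂ, ¬ a.toRatAlgHom.fieldRange ≤ normalClosure ℚ (K i₁) ℂ)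
    (h2 : ∀ (a : K i₀ →+* ℂ) (F : IntermediateField ℚ ℂ), F ≤ a.toRatAlgHom.fieldRange →
      F ≤ normalClosure ℚ (K i₁) ℂ → finrank ℚ F = 2 → ∀ z : ℂ, z ∈ F → starRingEnd ℂ z = z) :
    CMAlgebra.cmFamilyRank Φ + Fintype.card I = (∑ i, cmTypeRank (Φ i)) + 1 :=
  cmFamilyRank_add_card_eq_pair_of_forall_conj_apply_eq h01 hI Φ fun a k hk =>
    conj_apply_eq_of_finrank_eq_two_mul_prime hp hK a (h1 a) (h2 a) k hk

/-- … then the pair is nondegenerate iff both members are. [cite: Gordon1999HodgeAVSurvey, 7.5–7.6.1] -/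
theorem isNondegenerateFamily_iff_forall_of_finrank_eq_two_mul_prime {i₀ i₁ : I} (h01 : i₀ ≠ i₁)
    (hI : ∀ l, l = i₀ ∨ l = i₁) (Φ : ∀ i, CMType (K i)) {p : ℕ} (hp : p.Prime) (hK : finrank ℚ (K i₀) = 2 * p)
    (h1 : ∀ a : K i₀ →+* ℂ, ¬ a.toRatAlgHom.fieldRange ≤ normalClosure ℚ (K i₁) ℂ)
    (h2 : ∀ (a : K i₀ →+* ℂ) (F : IntermediateField ℚ ℂ), F ≤ a.toRatAlgHom.fieldRange →
      F ≤ normalClosure ℚ (K i₁) ℂ → finrank ℚ F = 2 → ∀ z : ℂ, z ∈ F → starRingEnd ℂ z = z) :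
    CMAlgebra.IsNondegenerateFamily Φ ↔ ∀ i, IsNondegenerate (Φ i) :=
  isNondegenerateFamily_iff_forall_of_forall_conj_apply_eq h01 hI Φ fun a k hk =>
    conj_apply_eq_of_finrank_eq_two_mul_prime hp hK a (h1 a) (h2 a) k hk

section HodgePrime

variable {Φ : ∀ i, CMType (K i)} {A : I → AbelianVariety ℂ} {ιA : ∀ i, 𝓞 (K i) →+* End (A i)}
  {θ : ∀ i, K i →+* Module.End ℂ (complexBetti (A i).X 1)}

/-- … and every rational Hodge class on every `A₀^a × A₁^b` (disjoint slot maps) is a sum of exterior products: a CM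
abelian variety of PRIME dimension carries no mixed exceptional class with a partner whose Galois closure neither
receives its field nor shares an imaginary quadratic field with it. [cite: MoonenZarhin1999LowDim, §3 (3.1) and Thm. (0.2)] -/
theorem forall_hodgeClassesProductSpan_pair_of_finrank_eq_two_mul_prime {i₀ i₁ : I} (h01 : i₀ ≠ i₁)
    (hI : ∀ l, l = i₀ ∨ l = i₁) {p : ℕ} (hp : p.Prime) (hK : finrank ℚ (K i₀) = 2 * p)
    (h1 : ∀ a : K i₀ →+* ℂ, ¬ a.toRatAlgHom.fieldRange ≤ normalClosure ℚ (K i₁) ℂ)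
    (h2 : ∀ (a : K i₀ →+* ℂ) (F : IntermediateField ℚ ℂ), F ≤ a.toRatAlgHom.fieldRange →
      F ≤ normalClosure ℚ (K i₁) ℂ → finrank ℚ F = 2 → ∀ z : ℂ, z ∈ F → starRingEnd ℂ z = z)
    (hA : ∀ i, IsCMTypeRealisation (Φ i) (A i) (ιA i) (θ i)) (N₁ N₂ : ℕ) [NeZero N₁] [NeZero N₂] (π₁ : Fin N₁ → I)
    (π₂ : Fin N₂ → I) (hdisj : ∀ l₁ l₂, π₁ l₁ ≠ π₂ l₂) :
    HodgeClassesProductSpan (⨁ fun l => A (π₁ l)) (⨁ fun l => A (π₂ l)) :=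
  forall_hodgeClassesProductSpan_pair_of_forall_conj_apply_eq h01 hI
    (fun a k hk => conj_apply_eq_of_finrank_eq_two_mul_prime hp hK a (h1 a) (h2 a) k hk) hA N₁ N₂ π₁ π₂ hdisj

/-- … and for nondegenerate types (e.g. `Φ₀` primitive: Yanai's theorem in prime dimension, tree `typeRank_eq_of_prime`)
every `A₀^a × A₁^b` satisfies the Hodge conjecture, unconditionally. [cite: Gordon1999HodgeAVSurvey, 10.10 and 7.5] -/
theorem hodgeConjectureFor_prod_of_finrank_eq_two_mul_prime {i₀ i₁ : I} (h01 : i₀ ≠ i₁) (hI : ∀ l, l = i₀ ∨ l = i₁)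
    {p : ℕ} (hp : p.Prime) (hK : finrank ℚ (K i₀) = 2 * p)
    (h1 : ∀ a : K i₀ →+* ℂ, ¬ a.toRatAlgHom.fieldRange ≤ normalClosure ℚ (K i₁) ℂ)
    (h2 : ∀ (a : K i₀ →+* ℂ) (F : IntermediateField ℚ ℂ), F ≤ a.toRatAlgHom.fieldRange →
      F ≤ normalClosure ℚ (K i₁) ℂ → finrank ℚ F = 2 → ∀ z : ℂ, z ∈ F → starRingEnd ℂ z = z)
    (hnd : ∀ i, IsNondegenerate (Φ i)) (hA : ∀ i, IsCMTypeRealisation (Φ i) (A i) (ιA i) (θ i)) {N : ℕ}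
    (π : Fin N → I) :
    HodgeConjectureFor (⨁ fun l : Fin N => A (π l)).dim (⨁ fun l : Fin N => A (π l)).X :=
  hodgeConjectureFor_prod_of_forall_conj_apply_eq h01 hI
    (fun a k hk => conj_apply_eq_of_finrank_eq_two_mul_prime hp hK a (h1 a) (h2 a) k hk) hnd hA π

end HodgePrime

end Summit.HodgeConjecture.CorCM

end
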